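import Summits.NavierStokesRegularity.NavierStokesRegularity.Theorems.FrequencyRigidity.Negative.FrequencyStructure
import Summits.NavierStokesRegularity.NavierStokesRegularity.Theorems.FrequencyRigidity.Negative.SelfSimilarSwirl
import Summits.NavierStokesRegularity.NavierStokesRegularity.Theorems.FrequencyRigidity.Negative.SmallLocalTypeI
import Literature.Analysis.FluidPDE.AdaptedBackwardKernel
import Literature.Analysis.FluidPDE.HyperbolicDSSOrbit

/-!
# Line `kernel-fading-memory` for crux `AdaptedFrequency.FrequencyRigidity`
# (stmt-NavierStokesRegularity-2955) — skeleton, generation 2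

Skeleton (crux-plan) of crux idea `Cruxes/FrequencyRigidity/Ideas/kernel-fading-memory.md`
(crux-ideate r1, ideator 2; triage r1-1 / r1-2 / r1-3: **pass ×3**). Generation 1
(planner-cruxplan-…-kernel-fading-memory-0, 2026-08-16T02:28Z) built the six-stub normal-form
reduction; generation 2 (planner-cruxplan-…-kernel-fading-memory-g2-0, same day) re-verified every
stub by hand, moved the vocabulary onto the LANDED negative-side modules
`Theorems/FrequencyRigidity/Negative/{Clauses, FrequencyStructure, RigidRotation, SelfSimilarSwirl,
SmallLocalTypeI}` (clause bundles `TypeIBound`, `KernelClauses`, `Comparable`, `FreqClause`,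
`frequencyRigidity_iff` and the pinning theorems (T) are IMPORTED, no longer copied), added the
seventh stub `stub_noSteadySlice` (closable now: Tsai `q = ∞` is PROVED in tree — triage r1-3 G3)
and PROVED anchors checking the stub set against the landed witnesses (A), (B), (B′), (C).

THE CRUX (fixed; route decl `AdaptedFrequency.FrequencyRigidity`, rank 3): there is NO smooth ancient
Navier–Stokes flow `(v,q)` on `ℝ³ × (−∞,0)` with the GLOBAL Type-I bound `‖v(t,x)‖ ≤ C/√(−t)`, an
adapted backward kernel `K` at the pole `(0,0)` (C², `K > 0`, `∂ₜK + v·∇K + νΔK = 0`, `∫K = 1`,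
`K(t) ⇀ δ₀`) that is two-sided Gaussian-comparable, positive adapted enstrophy
`H(t) = ∫‖curl v(t)‖²K(t)` and CONSTANT adapted frequency `Λ(t) = (−t)H′/H ≡ Λ₀`.
A WITNESS is a tuple `(ν, C, Λ₀, v, q, K)` inhabiting the `∃`-body (`IsWitness`,
`frequencyRigidity_iff` = the landed `Negative.frequencyRigidity_iff`).

THE LINE (the card's lever, read as a NORMAL-FORM REDUCTION). In reversed log-time `σ = log(−t)`
the rescaled kernel `K̃(σ,y) = (−t)^{3/2}K(t,√(−t)y)` solves the FORWARD Fokker–Planck equation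
`∂_σK̃ = νΔK̃ + div((U + ½y)K̃)` of the Ornstein–Uhlenbeck particle `dY = −(U(Y)+½Y)dσ + √(2ν)dB`
kicked by the bounded divergence-free similarity profile `U = lerayOrbit v` (`‖U‖ ≤ C` IS the global
Type-I bound). Lyapunov `𝓛|y|² = 6ν − |y|² − 2y·U ≤ 6ν + 2C² − ½|y|²` + Doeblin minorisation on
balls (bounded drift on a unit `σ`-window: the EASY Aronson regime, never the critical one at the
pole) ⇒ Harris' theorem: the flow is geometrically ergodic in total variation UNIFORMLY over the
Type-I class. Consequences, each a stub below: two window kernels MERGE exponentially in the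
number of e-folds (`stub_kernelMerging`, the LEVER) ⇒ the comparable adapted kernel is UNIQUE
(`isUniqueKernel_of_merging`, PROVED from the stub: the quantifier `∃K` of the crux becomes the
canonical functional `K = 𝒦[v]`) ⇒ the kernel inherits every parabolic screw symmetry of the flow
(`stub_kernelCovariance`: RSS flows carry co-rotating kernels, so `(−t)²H` is constant on them —
the certified enemy) and moves no faster than the flow's FUTURE unsteadiness
(`stub_kernelSlaving`, linear response through one mixing constant). Two normalisation stubs shared
with every line of this crux come first: `stub_kernelCentring` (the kernel's own mean is a canonical
Galilei gauge: `∫xK = 0`, hence `∫vK = 0` — kills the parasitic wobble of the raw classical class,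
cf. refuted stmt-4055) and `stub_witnessRegularity` (scale-invariant derivative bounds by KNSS
smoothing + differentiability of `H` by the kernel's first variation), after which PINNING
`Λ₀ = 2`, `H(t) = A(−t)^{−2}` is PROVED here (`flat_of_bounds`, from the LANDED theorem (T)
`Negative.FreqClause.exponent_eq_two` / `power_law`). The flat law puts vorticity on every time
slice, so `stub_noSteadySlice` (NEW in gen 2, closable now) says the similarity profile of the
witness is steady at NO instant: a steady slice `∂ₛU(s₀,·) ≡ 0` is a bounded Leray profile
(`IsBackwardLeraySolutionOn.momentum_leray`), hence constant by Tsai's bounded-profile theorem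
(`tsai_selfsimilar_bounded_holds`, PROVED in tree), hence irrotational — contradiction. The
composition `FrequencyRigidity_of` (kernel-checked, sorry-free) turns any witness into a CANONICAL
witness (`IsCanonicalWitness`: centred, scale-invariant bounds, flat rescaled enstrophy `A > 0`,
unique + symmetry-covariant + slaved kernel) that is moreover UNSTEADY AT EVERY SLICE, and hands it
to the terminal stub `stub_noCanonicalWitness` — the crux in canonical normal form, HARDEST and
OPEN: it contains the Liouville theorem for bounded-profile backward ROTATED self-similar flows for
every rotation speed `α ≠ 0` (Pineau–Vicol 2026 Conj. 1.1 = Bradshaw–Tsai OP 5.2 = Tsai GSM192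
Conj. 8.9, open for `α ≈ 1`). No line of this crux can avoid that wall (triage S1/G2, all three
triagers); what this line buys is that the wall is now stated for `v` ALONE with a causal kernel
functional, a fixed gauge, exact `Λ ≡ 2`, no steady slice, and the RSS shadow made explicit by
covariance.

DISPROOF USED — `Cruxes/FrequencyRigidity/Disproof.lean` (cdisprove v5, 2026-08-16T02:27Z, NO KILL)
and its LANDED modules, which this file IMPORTS and is checked against (section "Anchors" at the
end, all PROVED):
(A) `Negative.frequencyRigidity_false_without_posH` — positivity of `H` is used: `A = H(−1) > 0`
    (`IsCanonicalWitness.A_pos`) and "vorticity on every slice" (`exists_curl_ne_zero_of_flat`)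
    feed `stub_noSteadySlice`; uniqueness and slaving say nothing when `H ≡ 0` and the composition
    does not pretend they do (the free case `v ≡ 0` satisfies every reduction clause:
    `kernelClauses_zero_backwardHeatKernel`, `isCentred_zero_backwardHeatKernel`,
    `isSlaved_zero_backwardHeatKernel`).
(B) `Negative.frequencyRigidity_false_without_typeI` / `_false_with_local_typeI` and
(B′) `Negative.frequencyRigidity_false_with_local_typeI_small` — rigid rotation `Ω e₃ × x` violates
    the GLOBAL bound for every `Ω ≠ 0` and every `C` (`not_typeIBound_rot`,
    `not_isTypeIDriftPast_smul_rot`), so it is outside the hypotheses of stubs 1, 2, 3, 5, 6; the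
    global bound is USED by `stub_kernelMerging` / `stub_kernelSlaving` (uniform Lyapunov constant
    needs `‖U‖ ≤ C` on all of similarity space; for rigid rotation `U = e^{−s}Jy` is unbounded), by
    `stub_witnessRegularity` (KNSS on every parabolic slab, both ends), by `flat_of_bounds`
    (pinning at BOTH ends) and by `stub_noSteadySlice` (boundedness of the slice for Tsai).
(C) `Negative.frequencyRigidity_false_without_momentum` — the kinematic self-similar swirl passes
    EVERY drift-side clause of the normal form: Type-I drift (`isTypeIDriftPast_swirl`), kernel
    clauses and comparability for the heat kernel (`kernelClauses_swirl`,
    `Negative.comparable_backwardHeatKernel`), centred (`isCentred_swirl_backwardHeatKernel`), flat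
    with `A = ∫F > 0` (`flat_swirl`), steady similarity profile `lerayOrbit swirl = V`
    (`lerayOrbit_swirl`) with the steady canonical Gaussian kernel (`simKernel_backwardHeatKernel`),
    slaved with both sides `0` (`isSlaved_swirl_backwardHeatKernel`). It HAS a steady slice, so
    `stub_noSteadySlice` is precisely the named place where the momentum equation (through Tsai)
    removes it — the exposure (C) predicts, met by a closable stub rather than hidden in the
    terminal one.
(T) `Negative.FreqClause.differentiableAt / power_law / exponent_eq_two` — imported; its two inputs
    (`hd` from `stub_witnessRegularity`, the enstrophy bound from the vorticity bound + unit mass)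
    are supplied by `flat_of_bounds` (PROVED).
Negatives index (`ledger negatives`, 2026-08-16): stmt-0154, stmt-4055 — no stub is an instance;
4055's lesson (Galilei parasitic modes in the raw classical class) is the reason for
`stub_kernelCentring`.
-/

noncomputable section

namespace Summit.NavierStokesRegularity.NavierStokesRegularity.Cruxes.FrequencyRigidity.KernelFadingMemory

open MeasureTheory Set Filter Topology Function
open scoped Laplacian InnerProductSpace RealInnerProductSpace
open Literature.Analysis.FluidPDE
open Summit.NavierStokesRegularity.NavierStokesRegularity.Theses.AdaptedFrequency
open Summit.NavierStokesRegularity.NavierStokesRegularity.Theorems.FrequencyRigidity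
open Summit.NavierStokesRegularity.NavierStokesRegularity.Theorems.FrequencyRigidity.Negative
  (E3 TypeIBound KernelClauses Comparable FreqClause)

set_option linter.unusedVariables false
set_option linter.dupNamespace false

/-! ## Vocabulary

The clause bundles of the crux are the LANDED ones of
`Theorems/FrequencyRigidity/Negative/Clauses.lean` (`Negative.TypeIBound`, `Negative.KernelClauses`,
`Negative.Comparable`, `Negative.FreqClause`, `Negative.E3`), opened above; everything below is an
abbreviation over existing declarations (no new mathematics). -/

/-- Two-sided Gaussian comparability about the pole `(0,0)` with EXPLICIT constants (the body of
`Negative.Comparable`, verbatim: `Comparable K ↔ ∃ c₁ c₂ C₁ C₂ > 0, ComparableWith c₁ c₂ C₁ C₂ K`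
definitionally, `comparable_iff`). -/
def ComparableWith (c₁ c₂ C₁ C₂ : ℝ) (K : ℝ → E3 → ℝ) : Prop :=
  ∀ t ∈ Iio (0:ℝ), ∀ x,
    c₁ * ((0:ℝ) - t) ^ (-(3:ℝ) / 2) * Real.exp (-(‖x - (0 : E3)‖ ^ 2) / (c₂ * ((0:ℝ) - t))) ≤
        K t x ∧
      K t x ≤ C₁ * ((0:ℝ) - t) ^ (-(3:ℝ) / 2) * Real.exp (-(‖x - (0 : E3)‖ ^ 2) / (C₂ * ((0:ℝ) - t)))

/-- `Negative.Comparable` is `∃` positive constants with `ComparableWith` (definitional). -/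
theorem comparable_iff (K : ℝ → E3 → ℝ) :
    Comparable K ↔ ∃ c₁ c₂ C₁ C₂ : ℝ, 0 < c₁ ∧ 0 < c₂ ∧ 0 < C₁ ∧ 0 < C₂ ∧ ComparableWith c₁ c₂ C₁ C₂ K :=
  Iff.rfl

/-- A WITNESS against the crux: the `∃`-body of `FrequencyRigidity`, regrouped into the landed
clause bundles. -/
def IsWitness (ν C Λ₀ : ℝ) (v : ℝ → E3 → E3) (q : ℝ → E3 → ℝ) (K : ℝ → E3 → ℝ) : Prop :=
  0 < ν ∧ IsClassicalNSSolutionOn (Iio 0) ν 0 v q ∧ TypeIBound C v ∧ KernelClauses ν v K ∧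
    Comparable K ∧ FreqClause v K Λ₀

/-- Bookkeeping: the crux is literally `¬ ∃ witness` (the landed `Negative.frequencyRigidity_iff`). -/
theorem frequencyRigidity_iff :
    Summit.NavierStokesRegularity.NavierStokesRegularity.Theses.AdaptedFrequency.FrequencyRigidity ↔
      ¬ ∃ (ν C Λ₀ : ℝ) (v : ℝ → E3 → E3) (q : ℝ → E3 → ℝ) (K : ℝ → E3 → ℝ),
        IsWitness ν C Λ₀ v q K :=
  Negative.frequencyRigidity_iff

/-! ### Normal-form vocabulary -/

/-- **Centred gauge**: the kernel has mean zero and sees no mean flow,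
`∫ x K(t,x) dx = 0` and `∫ v(t,x) K(t,x) dx = 0` for every `t < 0` (the second is `d/dt` of the
first by the kernel pairing `d/dt ∫ fK = ∫ (∂ₜ + v·∇ − νΔ)f K` with `f = x`). -/
def IsCentred (v : ℝ → E3 → E3) (K : ℝ → E3 → ℝ) : Prop :=
  (∀ t ∈ Iio (0:ℝ), (∫ x, K t x • x) = (0 : E3)) ∧
    (∀ t ∈ Iio (0:ℝ), (∫ x, K t x • v t x) = (0 : E3))

/-- **Scale-invariant first-order bounds** of a Type-I ancient flow (KNSS smoothing on parabolic
slabs): `‖∇v(t,x)‖ ≤ C′/(−t)`, hence `‖curl v(t,x)‖ ≤ C′/(−t)`, and `‖∂ₜv(t,x)‖ ≤ C′(−t)^{−3/2}`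
(the last one is gauge-dependent: it holds in the centred gauge). -/
def HasScaleInvariantBounds (C' : ℝ) (v : ℝ → E3 → E3) : Prop :=
  ∀ t ∈ Iio (0:ℝ), ∀ x, ‖fderiv ℝ (v t) x‖ ≤ C' / (-t) ∧ ‖curl (v t) x‖ ≤ C' / (-t) ∧
    ‖timeDerivWithin (Iio (0:ℝ)) v t x‖ ≤ C' * (-t) ^ (-(3:ℝ) / 2)

/-- Gaussian UPPER bound `K(t,x) ≤ C₁(−t)^{-3/2}e^{−‖x‖²/(C₂(−t))}` on a time set `S` (the upper
half of the comparability clause, verbatim shape; tightness for Harris). -/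
def HasGaussianUpper (C₁ C₂ : ℝ) (K : ℝ → E3 → ℝ) (S : Set ℝ) : Prop :=
  ∀ t ∈ S, ∀ x,
    K t x ≤ C₁ * ((0:ℝ) - t) ^ (-(3:ℝ) / 2) * Real.exp (-(‖x - (0 : E3)‖ ^ 2) / (C₂ * ((0:ℝ) - t)))

/-- **Window kernel**: clauses (1)–(4) on a closed window `[t₁,t₂] ⊂ (−∞,0)` (no pole condition):
jointly `C²`, positive, adjoint equation with the one-sided time derivative within `[t₁,t₂]`,
unit mass. An adapted kernel on `Iio 0` restricts to a window kernel
(`IsAdaptedBackwardKernel.mono`, used in `isUniqueKernel_of_merging`). -/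
def IsWindowKernel (ν : ℝ) (v : ℝ → E3 → E3) (t₁ t₂ : ℝ) (K : ℝ → E3 → ℝ) : Prop :=
  ContDiffOn ℝ 2 (uncurry K) (Icc t₁ t₂ ×ˢ univ) ∧ (∀ t ∈ Icc t₁ t₂, ∀ x, 0 < K t x) ∧
    (∀ t ∈ Icc t₁ t₂, ∀ x,
      timeDerivWithin (Icc t₁ t₂) K t x + fderiv ℝ (K t) x (v t x) + ν * (Δ (K t)) x = 0) ∧
    (∀ t ∈ Icc t₁ t₂, ∫ x, K t x = 1)

/-- **Type-I divergence-free smooth drift on the past**: jointly smooth on `(−∞,0) × ℝ³`,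
divergence-free at every time, global Type-I bound — the ONLY properties of the velocity the two
kernel-side stubs (merging, slaving) use; for a witness they are fields of
`IsClassicalNSSolutionOn` plus `TypeIBound`. -/
def IsTypeIDriftPast (C : ℝ) (v : ℝ → E3 → E3) : Prop :=
  IsSmoothSpaceTimeOn (Iio 0) v ∧ (∀ t ∈ Iio (0:ℝ), VectorCalculus.IsDivFree (v t)) ∧ TypeIBound C v

/-- **Rescaled kernel in backward similarity variables** `K̃(s,y) = e^{−3s/2} K(−e^{−s}, e^{−s/2}y)`,
i.e. `(−t)^{3/2}K(t, √(−t)y)` at `t = −e^{−s}`, `s = −log(−t)` — the companion of the tree's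
similarity profile `U = lerayOrbit v`, `U(s,y) = e^{−s/2}v(−e^{−s}, e^{−s/2}y)`. `K̃(s,·)` is a
probability density; the adjoint clause reads `∂ₛK̃ = −νΔK̃ − div((U + ½y)K̃)`, i.e. in `σ = −s`
the FORWARD Fokker–Planck equation of `dY = −(U(Y) + ½Y)dσ + √(2ν)dB`. -/
def simKernel (K : ℝ → E3 → ℝ) (s : ℝ) (y : E3) : ℝ :=
  Real.exp (-(3:ℝ) / 2 * s) * K (-Real.exp (-s)) (Real.exp (-s / 2) • y)

/-- **Canonical kernel**: `K` is the ONLY kernel of `v` (clauses (1)–(5)) admitting some Gaussian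
upper bound — the conclusion of `isUniqueKernel_of_merging`. -/
def IsUniqueKernel (ν : ℝ) (v : ℝ → E3 → E3) (K : ℝ → E3 → ℝ) : Prop :=
  ∀ K' : ℝ → E3 → ℝ, KernelClauses ν v K' →
    (∃ C₁ C₂ : ℝ, 0 < C₁ ∧ 0 < C₂ ∧ HasGaussianUpper C₁ C₂ K' (Iio 0)) →
      ∀ t ∈ Iio (0:ℝ), ∀ x, K' t x = K t x

/-- **Symmetry inheritance**: for every parabolic screw symmetry of the flow on the past,
`c R⁻¹ v(c²t, cRx) = v(t,x)` (`c > 0`, `R` a linear isometry; the tree's `IsRotatedDSS c R v`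
restricted to `t < 0`, cf. `lerayOrbit_add_eq_symm_iff`), the kernel is covariant:
`K(t,x) = c³K(c²t, cRx)`. -/
def IsSymmetryCovariant (v : ℝ → E3 → E3) (K : ℝ → E3 → ℝ) : Prop :=
  ∀ (c : ℝ) (R : E3 ≃ₗᵢ[ℝ] E3), 0 < c →
    (∀ t ∈ Iio (0:ℝ), ∀ x, c • R.symm (v (c ^ 2 * t) (c • R x)) = v t x) →
      ∀ t ∈ Iio (0:ℝ), ∀ x, K t x = c ^ 3 * K (c ^ 2 * t) (c • R x)

/-- **Slaving (fading memory)** with constants `κ, M`: at every similarity time `s` the `L¹` speed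
of the rescaled kernel is bounded by an exponentially fading average of the weighted unsteadiness
of the similarity profile over the FUTURE `s + τ`, `τ > 0` (closer to the pole):
`∫|∂ₛK̃(s,y)|dy ≤ M ∫₀^∞ e^{−κτ} ∫‖∂ₛU(s+τ,y)‖(1+‖y‖²)²K̃(s+τ,y) dy dτ`. -/
def IsSlaved (κ M : ℝ) (v : ℝ → E3 → E3) (K : ℝ → E3 → ℝ) : Prop :=
  ∀ s : ℝ,
    (∫ y, |deriv (fun s' => simKernel K s' y) s|) ≤
      M * ∫ τ in Ioi (0:ℝ), Real.exp (-κ * τ) *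
        ∫ y, ‖deriv (fun s' => lerayOrbit v s' y) (s + τ)‖ * (1 + ‖y‖ ^ 2) ^ 2 * simKernel K (s + τ) y

/-- **CANONICAL WITNESS** — the normal form every witness can be brought to by the five
reduction stubs (`noWitness_of`): a witness (`ν, v, q, K`, Type-I constant `C`) which is moreover
centred, obeys scale-invariant first-order bounds with constant `C′`, has FLAT rescaled adapted
enstrophy `∫‖curl v(t)‖²K(t) = A(−t)^{−2}` with `A > 0` (so `Λ ≡ 2`), whose kernel is the unique
(canonical) one, covariant under every screw symmetry of `v`, and slaved to the future
unsteadiness of `v`. (Unsteadiness of the similarity profile is NOT a field: it is delivered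
separately by `stub_noSteadySlice` and added as a conjunct in the terminal stub, so that no stub is
vacuous.) -/
structure IsCanonicalWitness (ν C C' A : ℝ) (v : ℝ → E3 → E3) (q : ℝ → E3 → ℝ)
    (K : ℝ → E3 → ℝ) : Prop where
  nu_pos : 0 < ν
  A_pos : 0 < A
  ns : IsClassicalNSSolutionOn (Iio 0) ν 0 v q
  typeI : TypeIBound C v
  kernel : KernelClauses ν v K
  comparable : Comparable K
  centred : IsCentred v K
  bounds : HasScaleInvariantBounds C' v
  flat : ∀ t ∈ Iio (0:ℝ), (∫ x, ‖curl (v t) x‖ ^ 2 * K t x) = A * (-t) ^ (-(2:ℝ))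
  unique : IsUniqueKernel ν v K
  covariant : IsSymmetryCovariant v K
  slaved : ∃ κ M : ℝ, 0 < κ ∧ 0 < M ∧ IsSlaved κ M v K

/-! ## The seven stub statements (named `Prop`s; the registered `theorem stub_X` below restates the
SAME text, so `stub_X : <NamedStatement>` holds by `δ`-unfolding) -/

/-- Statement of `stub_kernelCentring`. -/
def KernelCentring : Prop :=
  ∀ (ν C Λ₀ : ℝ) (v : ℝ → E3 → E3) (q : ℝ → E3 → ℝ) (K : ℝ → E3 → ℝ), IsWitness ν C Λ₀ v q K →
    ∃ (B : ℝ → E3) (q' : ℝ → E3 → ℝ),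
      (∀ t ∈ Iio (0:ℝ), B t = ∫ x, K t x • x) ∧
      IsWitness ν (2 * C) Λ₀ (fun t x => v t (x + B t) - deriv B t) q' (fun t x => K t (x + B t)) ∧
      IsCentred (fun t x => v t (x + B t) - deriv B t) (fun t x => K t (x + B t))

/-- Statement of `stub_witnessRegularity`. -/
def WitnessRegularity : Prop :=
  ∀ (ν C Λ₀ : ℝ) (v : ℝ → E3 → E3) (q : ℝ → E3 → ℝ) (K : ℝ → E3 → ℝ), IsWitness ν C Λ₀ v q K →
    IsCentred v K →
      (∃ C' : ℝ, 0 ≤ C' ∧ HasScaleInvariantBounds C' v) ∧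
      (∀ t < 0, DifferentiableAt ℝ (fun t => ∫ x, ‖curl (v t) x‖ ^ 2 * K t x) t)

/-- Statement of `stub_kernelMerging` (the card's First lemma `KernelMerging`, sharpened by
triage r1-2: constants depend on `(ν, C, C₁, C₂, C₁′, C₂′)` only; drift-only hypotheses). -/
def KernelMerging : Prop :=
  ∀ ν C C₁ C₂ C₁' C₂' : ℝ, 0 < ν → 0 ≤ C → 0 < C₁ → 0 < C₂ → 0 < C₁' → 0 < C₂' →
    ∃ κ M : ℝ, 0 < κ ∧ 0 < M ∧
      ∀ (v : ℝ → E3 → E3) (K₁ K₂ : ℝ → E3 → ℝ) (t₁ t₂ : ℝ), t₁ < t₂ → t₂ < 0 →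
        IsTypeIDriftPast C v →
        IsWindowKernel ν v t₁ t₂ K₁ → IsWindowKernel ν v t₁ t₂ K₂ →
        HasGaussianUpper C₁ C₂ K₁ (Icc t₁ t₂) → HasGaussianUpper C₁' C₂' K₂ (Icc t₁ t₂) →
          (∫ x, |K₁ t₁ x - K₂ t₁ x|) ≤ M * ((-t₁) / (-t₂)) ^ (-κ)

/-- Statement of `stub_kernelCovariance`. -/
def KernelCovariance : Prop :=
  ∀ (ν : ℝ) (v : ℝ → E3 → E3) (K : ℝ → E3 → ℝ), 0 < ν →
    KernelClauses ν v K → Comparable K → IsUniqueKernel ν v K → IsSymmetryCovariant v K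

/-- Statement of `stub_kernelSlaving`. -/
def KernelSlaving : Prop :=
  ∀ ν C C' c₁ c₂ C₁ C₂ : ℝ, 0 < ν → 0 ≤ C → 0 ≤ C' → 0 < c₁ → 0 < c₂ → 0 < C₁ → 0 < C₂ →
    ∃ κ M : ℝ, 0 < κ ∧ 0 < M ∧
      ∀ (v : ℝ → E3 → E3) (K : ℝ → E3 → ℝ),
        IsTypeIDriftPast C v → HasScaleInvariantBounds C' v →
        KernelClauses ν v K → ComparableWith c₁ c₂ C₁ C₂ K → IsSlaved κ M v K

/-- Statement of `stub_noSteadySlice` (gen 2). -/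
def NoSteadySlice : Prop :=
  ∀ (ν C : ℝ) (v : ℝ → E3 → E3) (q : ℝ → E3 → ℝ), 0 < ν →
    IsClassicalNSSolutionOn (Iio 0) ν 0 v q → TypeIBound C v →
    (∀ t ∈ Iio (0:ℝ), ∃ x, curl (v t) x ≠ 0) →
      ∀ s : ℝ, (∀ y, deriv (fun s' => lerayOrbit v s' y) s = 0) → False

/-- Statement of `stub_noCanonicalWitness` (C⁺ of the card: the crux in canonical normal form, with
the unsteadiness-at-every-slice conjunct delivered by `stub_noSteadySlice`). -/
def NoCanonicalWitness : Prop :=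
  ¬ ∃ (ν C C' A : ℝ) (v : ℝ → E3 → E3) (q : ℝ → E3 → ℝ) (K : ℝ → E3 → ℝ),
    IsCanonicalWitness ν C C' A v q K ∧
      ∀ s : ℝ, ∃ y, deriv (fun s' => lerayOrbit v s' y) s ≠ 0

/-! ### Name-keyed aliases of the seven statements (the hypotheses of the composition)

`Registered.stub_X` is the statement of `stub_X` under the registered stub's short name, so that the
native skeleton audit (`#h21_check_skeleton`: hypotheses admissible iff registered obligations /
declared stubs BY NAME) accepts `FrequencyRigidity_of : Registered.stub_kernelCentring → … →
FrequencyRigidity`. Each alias is `rfl`-equal to the named statement. -/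
namespace Registered

/-- Alias of `KernelCentring` keyed by the registered stub name. -/
abbrev stub_kernelCentring : Prop := KernelCentring
/-- Alias of `WitnessRegularity` keyed by the registered stub name. -/
abbrev stub_witnessRegularity : Prop := WitnessRegularity
/-- Alias of `KernelMerging` keyed by the registered stub name. -/
abbrev stub_kernelMerging : Prop := KernelMerging
/-- Alias of `KernelCovariance` keyed by the registered stub name. -/
abbrev stub_kernelCovariance : Prop := KernelCovariance
/-- Alias of `KernelSlaving` keyed by the registered stub name. -/
abbrev stub_kernelSlaving : Prop := KernelSlaving
/-- Alias of `NoSteadySlice` keyed by the registered stub name. -/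
abbrev stub_noSteadySlice : Prop := NoSteadySlice
/-- Alias of `NoCanonicalWitness` keyed by the registered stub name. -/
abbrev stub_noCanonicalWitness : Prop := NoCanonicalWitness

end Registered

/-! ## Registered stubs (the ONLY `sorry`s of the file) -/

/-- **`stub_kernelCentring` — the kernel's mean is a canonical Galilei gauge (normalisation 1).**
For a witness `(ν,C,Λ₀,v,q,K)` put `B(t) := ∫ x K(t,x) dx` (the kernel's centre of mass;
`‖B(t)‖ ≤ β(C₁,C₂)√(−t) → 0` by the Gaussian upper bound). Then the Galilei transform
`v′(t,x) = v(t, x + B(t)) − B′(t)`, `q′(t,x) = q(t, x + B(t)) + ⟪B″(t), x⟫`, `K′(t,x) = K(t, x + B(t))`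
is again a witness, with Type-I constant `2C` and the SAME `ν, Λ₀` (indeed the same `H`), and it
is CENTRED: `∫ xK′ = 0` and `∫ v′K′ = 0`.
Why plausibly true (re-derived in gen 2): (i) kernel pairing `d/dt∫fK = ∫(∂ₜ+v·∇−νΔ)f K` with
`f = xᵢ` (cut-off `xᵢχ_R`, `R → ∞` by the Gaussian tail and `|v| ≤ C/√(−t)`; only CONTINUITY of
`∂ₜK`, i.e. clause (1), is needed, no derivative bounds on `K`) gives `B ∈ C¹`, `B′ = ∫ vK`, so
`‖B′‖ ≤ C/√(−t)` and `‖v′‖ ≤ 2C/√(−t)`; (ii) `B ∈ C^∞`: write `v = u(· − A(t), t) + A′(t)` with `u`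
the bounded ancient MILD representative (KNSS: the harmonic part of the pressure gradient of a
bounded classical solution is `x`-independent; `A ∈ C^∞`), so `B = A + B_u` with `B_u` the kernel
mean for the mild flow, whose derivatives `B_u′ = ∫uK̃`, `B_u″ = −∫∇p_u K̃`, … are pairings of
bounded smooth integrands (all derivatives of `u` and of `∇p_u` are bounded on `(−∞,t₀] × ℝ³`);
(iii) NS is Galilei-covariant with the affine pressure correction `⟪B″, x⟫`; the adjoint equation
is Galilei-covariant with NO correction (`∂ₜ[K(t,x+B)] + (v(x+B) − B′)·∇K(x+B) = (∂ₜK + v·∇K)(x+B)`);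
unit mass, positivity, `C²` are translation-invariant; concentration at `0` survives because
`B(t) → 0` and `K(t)` is tight at scale `√(−t)` (Gaussian upper bound); comparability survives
with new constants (`|x+B|² ≤ 2|x|² + 2β²(−t)`, `|x+B|² ≥ ½|x|² − β²(−t)`); `curl v′(t) =
(curl v(t))(· + B)` and `K′ = K(· + B)` give `H′ = H` by translation invariance of Lebesgue
measure, so `FreqClause` is untouched; (iv) `∫xK′ = ∫(x − B)K = 0` and `∫v′K′ = ∫vK − B′ = 0`.
Uses H = momentum equation (pressure correction), `div v = 0` (pairing), Type-I bound (size of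
`B′`). Size M–L. Leans on: `KNSSRegularityGalilean` (`galileanShift`, `driftPath`,
`fderiv_comp_sub_right`, `laplacian_comp_sub_right`, `divergence_comp_sub_right`),
`AncientMildRepresentative` / `AncientMildModification` (mild modulo Galilei),
`IsAdaptedBackwardKernel.{integrable, contDiff_slice}`, Mathlib `integral_add_right_eq_self`,
`MeasureTheory.integral_smul_const`, `hasDerivAt_integral_of_dominated_loc_of_deriv_le`. -/
theorem stub_kernelCentring :
    ∀ (ν C Λ₀ : ℝ) (v : ℝ → E3 → E3) (q : ℝ → E3 → ℝ) (K : ℝ → E3 → ℝ), IsWitness ν C Λ₀ v q K →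
      ∃ (B : ℝ → E3) (q' : ℝ → E3 → ℝ),
        (∀ t ∈ Iio (0:ℝ), B t = ∫ x, K t x • x) ∧
        IsWitness ν (2 * C) Λ₀ (fun t x => v t (x + B t) - deriv B t) q'
          (fun t x => K t (x + B t)) ∧
        IsCentred (fun t x => v t (x + B t) - deriv B t) (fun t x => K t (x + B t)) := by
  sorry

/-- **`stub_witnessRegularity` — scale-invariant bounds and `H ∈ C¹` (normalisation 2; the
"WitnessVorticityBound + KernelFirstVariation" layer all three triagers ask every line to start
with).** For a CENTRED witness: (a) there is `C′ ≥ 0` with `‖∇v(t,x)‖ ≤ C′/(−t)`,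
`‖curl v(t,x)‖ ≤ C′/(−t)`, `‖∂ₜv(t,x)‖ ≤ C′(−t)^{−3/2}` for all `t < 0`, `x`; (b) the adapted
enstrophy `H(t) = ∫‖curl v(t)‖²K(t)` is differentiable at every `t < 0`.
Why plausibly true (re-derived in gen 2): (a) a spatially bounded classical ancient solution is
mild modulo a Galilei wobble, `v = u(x − A(t), t) + A′(t)` with `u` bounded ancient mild (the
harmonic part of the pressure gradient of a bounded solution is `x`-independent: distributional
Liouville, KNSS 2009 §1/§3; `u` solves the projected equation, hence is mild on every window by
Tychonoff uniqueness for the heat equation in the bounded class). On a window `[t₁, t₁ + εν/M²]`,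
`M = C/√(−t₁) ≥ sup|v|` there, boost by the constant `A′(t₁)` so that `ũ(t₁) = v(t₁)`: local
uniqueness of bounded mild solutions gives `sup|ũ| ≤ 2M` on the window, hence the wobble velocity
oscillates by `≤ 3M` there (triage r1-2 finding 1), and KNSS smoothing for bounded mild solutions
at the END of the window gives `‖∇ᵏũ‖ ≲ M^{1+k}ν^{−k/2}`, `‖∂ₜũ‖, ‖∇p_ũ‖ ≲ M³/ν` — with
`M ~ C/√(−t)` these are the scale-invariant bounds `(−t)^{−(1+k)/2}`, `(−t)^{−3/2}`, uniformly on
`(−∞,0)` because the bound on `v` is GLOBAL in time (Disproof (B): locality would not do); `∇v`,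
`curl v` are wobble-blind; in the CENTRED gauge `A′ = −∫ u(·−A)K` (from `∫vK = 0`), so
`A″ = −∫(∂ₜ + v·∇ − νΔ)[u(·−A)]K = ∫(∇p_u)(·−A)K`, `‖∇p_u(t)‖∞ ≲ (−t)^{−3/2}` (Riesz transforms
of `∇(u⊗u)` with one derivative moved to the kernel far out), whence `‖∂ₜv‖ ≤ C′(−t)^{−3/2}`.
(b) `d/dt ∫‖curl v‖²K = ∫(∂ₜ+v·∇−νΔ)(‖curl v‖²)·K` by cut-off `χ_R`, the adjoint equation and two
integrations by parts (all derivatives land on `‖curl v‖²χ_R`; only the kernel's UPPER bound, the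
bounds of (a) and boundedness of second derivatives for fixed `t` are needed; `R → ∞` by the
Gaussian tail, locally uniformly in `t`). Uses H = NS (KNSS), GLOBAL Type-I bound, centring (for
`∂ₜv` only). Size L. Leans on: `KNSS2009_mild_regularity` /
`KNSS2009_regularity_boundedWeak_window_holds`, `KNSSMildGradientBound`, `AncientMildModification`
/ `AncientMildRepresentative` (mild modulo constants), `IsAdaptedBackwardKernel.adjoint_eq`,
`hasFDerivAt_integral_of_dominated_of_fderiv_le`. -/
theorem stub_witnessRegularity :
    ∀ (ν C Λ₀ : ℝ) (v : ℝ → E3 → E3) (q : ℝ → E3 → ℝ) (K : ℝ → E3 → ℝ), IsWitness ν C Λ₀ v q K →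
      IsCentred v K →
        (∃ C' : ℝ, 0 ≤ C' ∧ HasScaleInvariantBounds C' v) ∧
        (∀ t < 0, DifferentiableAt ℝ (fun t => ∫ x, ‖curl (v t) x‖ ^ 2 * K t x) t) := by
  sorry

/-- **`stub_kernelMerging` — Harris mixing of the reversed-log-time Fokker–Planck flow (THE LEVER;
the card's First lemma).** For `ν > 0`, `C ≥ 0` and upper-Gaussian constants `(C₁,C₂)`, `(C₁′,C₂′)`
there are `κ, M > 0` depending ONLY on these such that: for every Type-I divergence-free smooth
drift `v` on the past and every two window kernels `K₁, K₂` of `v` on `[t₁,t₂] ⊂ (−∞,0)` with the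
respective Gaussian upper bounds, `∫|K₁(t₁,x) − K₂(t₁,x)|dx ≤ M((−t₁)/(−t₂))^{−κ}` — exponentially
small in the number of e-folds `log((−t₁)/(−t₂))` separating the two ends of the window.
Why plausibly true (triage r1-1 S4, r1-2, r1-3 re-derived the set-up; gen 2 re-checked the time
direction through the SDE: `K(−τ,·)` is the law of the noisy backward Lagrangian particle
`dX = −v(−τ,X)dτ + √(2ν)dB`, `τ = −t` increasing into the past, and `Y = X/√τ`, `σ = log τ` obeys
`dY = −(U + ½Y)dσ + √(2ν)dB̃`): in `σ = log(−t)` and `y = x/√(−t)` the rescaled kernels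
`K̃ᵢ(σ,y) = (−t)^{3/2}Kᵢ(t,√(−t)y)` solve the SAME forward Fokker–Planck equation
`∂_σK̃ = νΔK̃ + div((U+½y)K̃)`, `U(σ,·) = √(−t)v(t,√(−t)·)`, `‖U‖ ≤ C` (this IS the global Type-I
bound), `div U = 0`, from `σ₂ = log(−t₂)` to `σ₁ = log(−t₁)`; they ARE the FP evolutions (laws) of
their slices at `t₂` (uniqueness of probability solutions of the FPK Cauchy problem under the
Lyapunov condition below, BKRS 2015 Ch. 9 — triage r1-2's sharpening, part of this stub).
Lyapunov: `𝓛|y|² = 6ν − |y|² − 2y·U ≤ 6ν + 2C² − ½|y|²`; minorisation: over one unit of `σ` the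
transition density from `y ∈ B_R` is bounded below on `B_R` by `η(ν,C,R) > 0` (drift `U + ½y`
bounded by `C + R` on `B_{2R}`, nondegenerate noise: small-time Aronson / two-point Harnack lower
bound for the process killed outside `B_{2R}` — the EASY bounded-drift regime, never the critical
one at the pole). Harris' theorem in the Hairer–Mattingly form (one-step contraction, hence valid
for the non-autonomous chain with UNIFORM constants) contracts the weighted total-variation distance
`‖·‖_{1+β|y|²}` of any two solutions by a factor `ᾱ < 1` per unit of `σ`; the weighted norm at `σ₂`
is bounded by `2 + β∫|y|²(K̃₁+K̃₂)(σ₂) ≤ c(C₁,C₂,C₁′,C₂′)` (tightness = Gaussian UPPER bound + unit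
mass; no lower bound needed); TV is non-expansive on the last fractional step; finally
`‖·‖_{L¹(dx)} = ‖·‖_{L¹(dy)}` and `ᾱ^{σ₁−σ₂} = ((−t₁)/(−t₂))^{−κ}`, `κ = −log ᾱ`. With `M ≥ 2` the
bound is trivial on short windows. Sanity (gen 2): in the free case the heat kernel displaced by
`m₀` is admitted on a window only if `−t₂ ≳ |m₀|²`, and then the claimed bound holds with
`κ = ½` (first Hermite mode) and `M = M(C₁′, ν)` — no contradiction with non-uniqueness of poles.
Uses H = GLOBAL Type-I bound (uniform Lyapunov constant), `div v = 0` (mass conservation / Markov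
property), smoothness (classical transition densities). Size L–XL (Harris' theorem is not in
Mathlib; the parabolic lower bound exists in tree as `exists_twoPointHarnack` /
`Lieberman1996_weak_harnack_holds`). Leans on: HairerMattingly2011 (arXiv:0810.2777, Thm 1.2/3.1),
Aronson1967 Thm 1 / Friedman1964 Ch.1 §8 (bounded drift, unit window), BKRS2015 Ch. 3 & 9
(uniqueness classes for FPK equations), tree `IsDriftHeatSolutionOn`, `exists_twoPointHarnack`,
`driftHeat_comparison`, `contDiff_uncurry_lerayOrbit`, `AncientSimilarityVariables` chain rules. -/
theorem stub_kernelMerging :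
    ∀ ν C C₁ C₂ C₁' C₂' : ℝ, 0 < ν → 0 ≤ C → 0 < C₁ → 0 < C₂ → 0 < C₁' → 0 < C₂' →
      ∃ κ M : ℝ, 0 < κ ∧ 0 < M ∧
        ∀ (v : ℝ → E3 → E3) (K₁ K₂ : ℝ → E3 → ℝ) (t₁ t₂ : ℝ), t₁ < t₂ → t₂ < 0 →
          IsTypeIDriftPast C v →
          IsWindowKernel ν v t₁ t₂ K₁ → IsWindowKernel ν v t₁ t₂ K₂ →
          HasGaussianUpper C₁ C₂ K₁ (Icc t₁ t₂) → HasGaussianUpper C₁' C₂' K₂ (Icc t₁ t₂) →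
            (∫ x, |K₁ t₁ x - K₂ t₁ x|) ≤ M * ((-t₁) / (-t₂)) ^ (-κ) := by
  sorry

/-- **`stub_kernelCovariance` — symmetric flows have symmetric kernels.** If `K` satisfies the
kernel clauses for `v`, is comparable, and is the UNIQUE such kernel with a Gaussian upper bound
(`IsUniqueKernel`, delivered by merging), then for every parabolic screw symmetry of the flow on the
past, `c R⁻¹ v(c²t, cRx) = v(t,x)` (`c > 0`, `R ∈ O(3)`), the kernel is covariant:
`K(t,x) = c³K(c²t, cRx)` for `t < 0`.
Why plausibly true (pure kernel calculus, no NS; re-derived in gen 2): `K′(t,x) := c³K(c²t, cRx)`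
satisfies the five clauses for the SAME drift — `∂ₜK′ = c⁵(∂ₜK)(c²t,cRx)`; `DK′(t,x)[v(t,x)] =
c⁴DK(c²t,cRx)[R v(t,x)] = c⁵ DK(c²t,cRx)[v(c²t,cRx)]` by the symmetry; `ΔK′ = c⁵(ΔK)(c²t,cRx)`
(Laplacian commutes with isometries and scales by `c²`); unit mass and concentration at `0` by the
change of variables `y = cRx` (Jacobian `c³`, `R0 = 0`, `c²t ↑ 0` maps `𝓝[<]0` to itself, the test
function `φ ∘ (c⁻¹R⁻¹)` is again bounded continuous); positivity and `C²` are clear — and it has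
the SAME Gaussian constants (`‖cRx‖² /(C₂c²(−t)) = ‖x‖²/(C₂(−t))`, `c³(−c²t)^{−3/2} = (−t)^{−3/2}`).
Uniqueness gives `K′ = K`. Consequence recorded for the disprover / terminal prover: for a backward
ROTATED SELF-SIMILAR flow `v = pvAnsatz α U₀` (screw-invariant for all `c` with `R = rotZ(2α log c)`)
the canonical kernel co-rotates, `K̃(s,y) = 𝔎₀(R(−αs)y)`, so `(−t)²H ≡ ∫|curl U₀|²𝔎₀` is CONSTANT
and `Λ ≡ 2`: bounded RSS profiles with a comparable kernel inhabit `IsCanonicalWitness` (and are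
unsteady at every slice when `α ≠ 0` and `U₀` is not axisymmetric) unless a Liouville theorem
removes them (triage S1/G2; card `RSSGivesConstantFrequency`). Size M.
Leans on: Mathlib `LinearIsometryEquiv` calculus (`fderiv` of `x ↦ c • R x`,
`MeasureTheory.Measure.integral_comp_smul`, `LinearIsometryEquiv.measurePreserving`),
`InnerProductSpace.laplacian_eq_iteratedFDeriv_stdOrthonormalBasis` (rotation invariance of `Δ`, cf.
`IsometryInvariance.lean`), `derivWithin_of_mem_nhds` for the time chain rule. -/
theorem stub_kernelCovariance :
    ∀ (ν : ℝ) (v : ℝ → E3 → E3) (K : ℝ → E3 → ℝ), 0 < ν →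
      KernelClauses ν v K → Comparable K → IsUniqueKernel ν v K → IsSymmetryCovariant v K := by
  sorry

/-- **`stub_kernelSlaving` — linear response: the kernel moves only as fast as the flow WILL
(fading memory of the future).** For `ν > 0`, `C, C′ ≥ 0` and comparability constants there are
`κ, M > 0` depending ONLY on these such that for every Type-I divergence-free smooth drift `v` on
the past with scale-invariant first-order bounds `C′` and every comparable kernel `K` of `v`
(clauses (1)–(5)), at every similarity time `s`:
`∫|∂ₛK̃(s,y)|dy ≤ M ∫₀^∞ e^{−κτ} ∫‖∂ₛU(s+τ,y)‖(1+‖y‖²)²K̃(s+τ,y) dy dτ`, `U = lerayOrbit v`,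
`K̃ = simKernel K` (the right side is a finite honest integral: `‖∂ₛU(s,y)‖ ≤ ½C + C′ + ½C′‖y‖`
from the bounds, and `K̃` has Gaussian tails). In particular a profile that is steady from `s` on
has a steady kernel at `s`; an RSS profile (rigidly rotating pattern) has a rigidly rotating kernel;
and the sibling lever's secular law `Cesàro-mean(−∫P∂ₛK̃) = νA` becomes a statement about `v`
alone (`νA ≤ M · osc P · mean future unsteadiness`).
Why plausibly true (re-derived in gen 2, size revised upward): `W := ∂_σK̃` (`σ = −s`) solves the
linearised FP equation `∂_σW = νΔW + div((U+½y)W) + div((∂_σU)K̃)`, a ZERO-MASS source problem, and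
since `div ∂_σU = 0` the source is `div((∂_σU)K̃) = ∂_σU·∇K̃ = (∂_σU·∇log K̃)K̃` — an honest `L¹`
function once the LOG-GRADIENT bound `|∇log K̃(s,y)| ≲ 1 + |y|` is known (Hamilton-type gradient
estimate for positive solutions of the drift–heat equation on a slab of length `∼(−t)`: `|∇log K|² ≲
(−t)^{−1}log(M/K)` with `log(M/K) ≲ 1 + |y|²` by TWO-SIDED comparability — the lower Gaussian bound
is used here); so no `τ^{−1/2}` short-time singularity arises (the Markov semigroup is an `L¹`
contraction on signed measures). Duhamel from `σ₀ → −∞`; the Harris contraction of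
`stub_kernelMerging` in the weighted norm `‖·‖_{1+β|y|²}` applies verbatim to zero-mass signed data
(`h = m(μ − μ′)` with `μ ⊥ μ′`), giving the factor `e^{−κ(σ−σ′)} = e^{−κτ}`; the boundary term
`P_{σ₀→σ}W(σ₀)` dies as `σ₀ → −∞` (toward the pole) because `‖W(σ₀)‖_{L¹(1+|y|²)}` is bounded
uniformly in `σ₀` (interior `W^{2,1}_p`/Schauder estimates on unit `σ`-windows in similarity
variables: `U` bounded by `C`, `∇U` by `C′`, `K̃` squeezed between fixed Gaussians). The weight power
`2` is a deliberate hedge. Uses H = GLOBAL Type-I bound + scale-invariant gradient bound (uniform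
constants), `div v = 0`, BOTH halves of comparability. Size L–XL. If a worker returns
`stub-misstated` (weight/norm), the lead reshapes `IsSlaved` without touching the composition
(it is one field of `IsCanonicalWitness`). Leans on: `stub_kernelMerging`'s machinery (same Harris
constants), HairerMattingly2011 §3, Friedman1964 Ch.1 Thm 11 / Lieberman1996 Thm 4.9 (interior
Schauder), Hamilton1993-type log-gradient bounds with drift, tree `contDiff_uncurry_lerayOrbit`,
`lerayOrbit_apply`, `hasDerivAt_lerayOrbit`; Mathlib `MeasureTheory.integral_Ioi_*`,
`hasDerivAt_integral_of_dominated_loc_of_deriv_le`. -/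
theorem stub_kernelSlaving :
    ∀ ν C C' c₁ c₂ C₁ C₂ : ℝ, 0 < ν → 0 ≤ C → 0 ≤ C' → 0 < c₁ → 0 < c₂ → 0 < C₁ → 0 < C₂ →
      ∃ κ M : ℝ, 0 < κ ∧ 0 < M ∧
        ∀ (v : ℝ → E3 → E3) (K : ℝ → E3 → ℝ),
          IsTypeIDriftPast C v → HasScaleInvariantBounds C' v →
          KernelClauses ν v K → ComparableWith c₁ c₂ C₁ C₂ K → IsSlaved κ M v K := by
  sorry

/-- **`stub_noSteadySlice` — a Type-I classical ancient flow with vorticity on every time slice is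
steady in similarity variables at NO instant (gen 2; closable now; triage r1-3 G3).** For
`(v,q)` classical NS on `ℝ³ × (−∞,0)` with the global Type-I bound `C` and `curl v(t) ≢ 0` for every
`t < 0`, there is no `s₀` with `∂ₛU(s₀,·) ≡ 0`, `U = lerayOrbit v`.
Why true: `(U, P) = (lerayOrbit v, lerayOrbitPressure q)` solves the backward Leray system on
`univ` (`isClassicalNSSolutionOn_Iio_iff_isBackwardLeraySolutionOn`, PROVED), whose momentum
equation at `s₀` reads `∂ₛU + ½U + ½(y·∇)U + (U·∇)U + ∇P = νΔU`
(`IsBackwardLeraySolutionOn.momentum_leray`; `timeDerivWithin univ = deriv`); with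
`∂ₛU(s₀,·) = 0` the slice `(U(s₀), P(s₀))` is a Leray profile `IsLerayProfile ν (1/2)` (smooth,
divergence-free), BOUNDED by `C` (`‖U(s₀,y)‖ = e^{−s₀/2}‖v(−e^{−s₀}, ·)‖ ≤ C`), hence CONSTANT by
Tsai's theorem at `q = ∞` (`tsai_selfsimilar_bounded_holds` /
`IsLerayProfile.exists_eq_const_of_bounded`, PROVED in tree); then `v(t₀,·) = e^{s₀/2}U(s₀, e^{s₀/2}·)`
is constant and `curl v(t₀) ≡ 0` (`t₀ = −e^{−s₀}`), contradicting the vorticity hypothesis.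
This is the stub where the MOMENTUM EQUATION enters the line before the terminal wall: the
kinematic swirl of Disproof (C) passes every drift-side clause of the normal form and IS steady
(`lerayOrbit_swirl` below), and only this stub removes it. Uses H = NS (profile equation), GLOBAL
Type-I (boundedness of the slice), vorticity `≢ 0` (from `H > 0` via the flat law,
`exists_curl_ne_zero_of_flat`). Size M. Leans on: `isClassicalNSSolutionOn_Iio_iff_isBackwardLeraySolutionOn`,
`IsBackwardLeraySolutionOn.momentum_leray`, `hasDerivAt_lerayOrbit`, `lerayOrbit_apply`,
`IsLerayProfile`, `tsai_selfsimilar_bounded_holds`, `Negative.curl_const`. -/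
theorem stub_noSteadySlice :
    ∀ (ν C : ℝ) (v : ℝ → E3 → E3) (q : ℝ → E3 → ℝ), 0 < ν →
      IsClassicalNSSolutionOn (Iio 0) ν 0 v q → TypeIBound C v →
      (∀ t ∈ Iio (0:ℝ), ∃ x, curl (v t) x ≠ 0) →
        ∀ s : ℝ, (∀ y, deriv (fun s' => lerayOrbit v s' y) s = 0) → False := by
  sorry

/-- **`stub_noCanonicalWitness` — the crux in CANONICAL NORMAL FORM (terminal stub; HARDEST;
OPEN).** There is no canonical witness that is unsteady at every similarity slice: no smooth
ancient NS flow `(v,q)` on `ℝ³ × (−∞,0)` with the global Type-I bound, a comparable adapted kernel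
`K` at `(0,0)` which is moreover CENTRED (`∫xK = ∫vK = 0`), with scale-invariant first-order
bounds, FLAT rescaled adapted enstrophy `∫‖curl v(t)‖²K(t) = A(−t)^{−2}`, `A > 0` (i.e. `Λ ≡ 2`
and the exact backward-self-similar enstrophy law), whose kernel is the UNIQUE comparable kernel of
`v` (so `K = 𝒦[v]`: the object is `v` alone), covariant under every screw symmetry of `v`, slaved
to the future unsteadiness of `v`, and whose similarity profile `U = lerayOrbit v` satisfies
`∂ₛU(s,·) ≢ 0` for EVERY `s` (no steady slice). By `noWitness_of` this is EQUIVALENT to the crux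
given the six reduction stubs (C⁺ of the card, weaker-by-hypotheses, not stronger).
Why it might fail / what it contains (honest): a bounded backward ROTATED self-similar profile
`U₀ ≢ const` with rotation speed `α ≠ 0` (Pineau–Vicol 2026 (1.7)–(1.8)) whose flow admits a
comparable kernel would, by `stub_kernelCovariance`, be a canonical witness (`Λ ≡ 2` forced,
co-rotating kernel, slaving satisfied with rigid rotation, every slice unsteady unless `U₀` is
axisymmetric about the rotation axis — and then it is steady and dead by `stub_noSteadySlice`); such
profiles are excluded only for `|α| < α₁(C)` and `|α| > α₂(C)` and only in the DECAYING class
`|v| ≤ C/(|x|+√(−t))` (`pineauVicol2026_rss_liouville`, named fact; arXiv:2607.09619 Thm 1.4);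
`α ≈ 1` is PV Conj. 1.1 = BradshawTsai2017CPDE OP 5.2 = Tsai GSM192 Conj. 8.9. So this stub ⊇
bounded-profile RSS-Liouville for all `α ≠ 0`. Known sub-cases a prover can dispatch inside the
canonical class: small Type-I constant `C < ε₀√ν` ⇒ no witness at all (Duhamel gap
`M ≤ κν^{−1/2}M²`, Disproof header); `|α| ≪ 1` RSS in the bounded class ⇒ `𝓗₀ ≤ 4α²` (rotation-gauged
head, `Cruxes/FrequencyRigidity/Ideator1TorqueProof.lean`, proved) + an enstrophy-gap lemma for
bounded profiles (not yet proved); a witness whose canonical KERNEL is steady in similarity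
variables ⇒ the sibling kernel-paired head budget gives `∫E ds < ∞`, contradicting `A > 0`
(kernel-paired-head-pressure line). What the normal form offers beyond the raw crux: no `∃K` (every
estimate on `∂ₛK̃` is an estimate on `∂ₛU` through `M, κ`), no Galilei junk, exact `Λ ≡ 2`, no
steady slice, dilation-invariance of the class with FIXED constants (closed under `v ↦ v_λ` and
under local smooth limits — the hull/extremal-element phase space of the card's point (4),
deliberately NOT a stub here: route RecurrentProfiles owns minimal sets of the scaling flow). Size:
crux-sized (open problem); a lead who reaches it reports `promote-stub`. Leans on:
`pineauVicol2026_rss_liouville` (unproved named fact, insufficient), `necas_ruzicka_sverak_holds`,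
`KNSS2009_liouville_*`, sibling stubs `KernelHeadBudget` / `SecularPressureWork` /
`rotatingBernoulliIdentity_rss` (Ideator3Sketch.lean, SketchIdeator2.lean, Ideator1TorqueProof.lean). -/
theorem stub_noCanonicalWitness :
    ¬ ∃ (ν C C' A : ℝ) (v : ℝ → E3 → E3) (q : ℝ → E3 → ℝ) (K : ℝ → E3 → ℝ),
      IsCanonicalWitness ν C C' A v q K ∧
        ∀ s : ℝ, ∃ y, deriv (fun s' => lerayOrbit v s' y) s ≠ 0 := by
  sorry

/-! ## Composition (kernel-checked; no `sorry` below this line except through the stubs in the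
wiring check) -/

/-- Reducible alias of the crux decl, so that exactly ONE theorem of the file —
`FrequencyRigidity_of` — concludes `AdaptedFrequency.FrequencyRigidity` literally by name. -/
abbrev FrequencyRigidity' : Prop :=
  Summit.NavierStokesRegularity.NavierStokesRegularity.Theses.AdaptedFrequency.FrequencyRigidity

/-- **Pinning and flattening (PROVED, from the landed (T)).** For a configuration with the
frequency clause, `H` differentiable on `(−∞,0)`, kernel clauses and the scale-invariant vorticity
bound `C′`: the two-ended enstrophy bound `H(t) ≤ C′²(−t)^{−2}` holds (unit mass, `K > 0`), so (T)
pins `Λ₀ = 2` and `H(t) = A(−t)^{−2}` EXACTLY with `A = H(−1)`. -/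
theorem flat_of_bounds {ν C' Λ₀ : ℝ} {v : ℝ → E3 → E3} {K : ℝ → E3 → ℝ}
    (hF : FreqClause v K Λ₀)
    (hd : ∀ t < 0, DifferentiableAt ℝ (fun t => ∫ x, ‖curl (v t) x‖ ^ 2 * K t x) t)
    (hK : KernelClauses ν v K) (hb : HasScaleInvariantBounds C' v) :
    Λ₀ = 2 ∧ ∀ t ∈ Iio (0:ℝ), (∫ x, ‖curl (v t) x‖ ^ 2 * K t x) =
      (∫ x, ‖curl (v (-1)) x‖ ^ 2 * K (-1) x) * (-t) ^ (-(2:ℝ)) := by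
  have hA : IsAdaptedBackwardKernel ν v (Iio 0) 0 0 K := isAdaptedBackwardKernel_iff.2 hK
  -- the two-ended enstrophy bound from the vorticity bound and unit mass
  have hM : ∀ t < 0, (∫ x, ‖curl (v t) x‖ ^ 2 * K t x) ≤ C' ^ 2 * (-t) ^ (-(2:ℝ)) := by
    intro t ht
    have ht' : t ∈ Iio (0:ℝ) := ht
    have hnt : 0 ≤ -t := by linarith
    have hrhs : C' ^ 2 * (-t) ^ (-(2:ℝ)) = (C' / (-t)) ^ 2 := by
      rw [Real.rpow_neg hnt, Real.rpow_two, div_pow, div_eq_mul_inv]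
    have hpt : ∀ x, ‖curl (v t) x‖ ^ 2 * K t x ≤ (C' / (-t)) ^ 2 * K t x := fun x =>
      mul_le_mul_of_nonneg_right
        (pow_le_pow_left₀ (norm_nonneg _) (hb t ht' x).2.1 2) (hK.2.1 t ht' x).le
    have hKi : Integrable (K t) := hA.integrable ht'
    have hone : ∫ x, (C' / (-t)) ^ 2 * K t x = (C' / (-t)) ^ 2 := by
      rw [integral_const_mul, hK.2.2.2.1 t ht', mul_one]
    rw [hrhs]
    by_cases hint : Integrable (fun x => ‖curl (v t) x‖ ^ 2 * K t x)
    · calc (∫ x, ‖curl (v t) x‖ ^ 2 * K t x) ≤ ∫ x, (C' / (-t)) ^ 2 * K t x :=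
            integral_mono hint (hKi.const_mul _) hpt
        _ = (C' / (-t)) ^ 2 := hone
    · rw [integral_undef hint]
      positivity
  have hΛ : Λ₀ = 2 := hF.exponent_eq_two hd hM
  refine ⟨hΛ, fun t ht => ?_⟩
  have h := hF.power_law hd (show t < 0 from ht)
  rw [hΛ] at h
  exact h

/-- **Vorticity on every slice (PROVED).** A flat adapted enstrophy `A(−t)^{−2}` with `A > 0`
forces `curl v(t) ≢ 0` at every `t < 0` (the input of `stub_noSteadySlice`; positivity of `H` is
used here — Disproof (A)). -/
theorem exists_curl_ne_zero_of_flat {A : ℝ} {v : ℝ → E3 → E3} {K : ℝ → E3 → ℝ} (hA : 0 < A)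
    (hflat : ∀ t ∈ Iio (0:ℝ), (∫ x, ‖curl (v t) x‖ ^ 2 * K t x) = A * (-t) ^ (-(2:ℝ))) :
    ∀ t ∈ Iio (0:ℝ), ∃ x, curl (v t) x ≠ 0 := by
  intro t ht
  by_contra hno
  push Not at hno
  have ht0 : t < 0 := ht
  have h0 : (∫ x, ‖curl (v t) x‖ ^ 2 * K t x) = 0 := by simp [hno]
  have hpos : 0 < A * (-t) ^ (-(2:ℝ)) := mul_pos hA (Real.rpow_pos_of_pos (by linarith) _)
  linarith [hflat t ht]

/-- **Uniqueness of the comparable kernel from merging (PROVED)** — the card's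
`KernelMerging ⇒ ComparableKernelUnique`: restrict both kernels to windows `[t₁,t₂]`
(`IsAdaptedBackwardKernel.mono`), merge, and let `t₂ ↑ 0`: the `L¹` distance at `t₁` is bounded
by `M(−t₁)^{−κ}(−t₂)^{κ} → 0`, so the continuous slices coincide. The pole is never touched
(no regularity at `(0,0)` is used — unlike the forward-duality proof through the critical drift,
SSSZ arXiv:1010.6025; orthogonal to crux 2956). -/
theorem isUniqueKernel_of_merging (hMerge : KernelMerging) {ν C : ℝ} {v : ℝ → E3 → E3}
    {K : ℝ → E3 → ℝ} (hν : 0 < ν) (hC : 0 ≤ C) (hv : IsTypeIDriftPast C v)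
    (hK : KernelClauses ν v K) (hKc : Comparable K) : IsUniqueKernel ν v K := by
  intro K' hK' hK'up t₁ ht₁ x
  obtain ⟨c₁, c₂, C₁, C₂, hc₁, hc₂, hC₁, hC₂, hcw⟩ := hKc
  obtain ⟨C₁', C₂', hC₁', hC₂', hup'⟩ := hK'up
  obtain ⟨κ, M, hκ, hMpos, hmerge⟩ := hMerge ν C C₁' C₂' C₁ C₂ hν hC hC₁' hC₂' hC₁ hC₂
  have hA : IsAdaptedBackwardKernel ν v (Iio 0) 0 0 K := isAdaptedBackwardKernel_iff.2 hK
  have hA' : IsAdaptedBackwardKernel ν v (Iio 0) 0 0 K' := isAdaptedBackwardKernel_iff.2 hK'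
  have ht₁0 : t₁ < 0 := ht₁
  -- merging on every window `[t₁, t₂] ⊂ (−∞, 0)`
  have hbound : ∀ t₂ ∈ Ioo t₁ 0, (∫ y, |K' t₁ y - K t₁ y|) ≤ M * ((-t₁) / (-t₂)) ^ (-κ) := by
    intro t₂ ht₂
    have hsub : Icc t₁ t₂ ⊆ Iio (0:ℝ) := fun t ht => lt_of_le_of_lt ht.2 ht₂.2
    have hU : UniqueDiffOn ℝ (Icc t₁ t₂) := uniqueDiffOn_Icc ht₂.1
    have hW : IsWindowKernel ν v t₁ t₂ K := by
      have h := hA.mono hsub hU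
      exact ⟨h.contDiffOn, h.pos, h.adjoint_eq, h.integral_eq_one⟩
    have hW' : IsWindowKernel ν v t₁ t₂ K' := by
      have h := hA'.mono hsub hU
      exact ⟨h.contDiffOn, h.pos, h.adjoint_eq, h.integral_eq_one⟩
    have hu' : HasGaussianUpper C₁' C₂' K' (Icc t₁ t₂) := fun t ht y => hup' t (hsub ht) y
    have hu : HasGaussianUpper C₁ C₂ K (Icc t₁ t₂) := fun t ht y => (hcw t (hsub ht) y).2
    exact hmerge v K' K t₁ t₂ ht₂.1 ht₂.2 hv hW' hW hu' hu
  -- hence the L¹ distance at `t₁` vanishes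
  have hint : Integrable (fun y => |K' t₁ y - K t₁ y|) :=
    ((hA'.integrable ht₁).sub (hA.integrable ht₁)).abs
  have hnonneg : 0 ≤ ∫ y, |K' t₁ y - K t₁ y| := integral_nonneg fun y => abs_nonneg _
  have hzero : (∫ y, |K' t₁ y - K t₁ y|) = 0 := by
    refine le_antisymm ?_ hnonneg
    have hg : Tendsto (fun t₂ : ℝ => M * ((-t₁) ^ (-κ) * (-t₂) ^ κ)) (𝓝[<] (0:ℝ)) (𝓝 0) := by
      have h1 : Tendsto (fun t₂ : ℝ => (-t₂) ^ κ) (𝓝 (0:ℝ)) (𝓝 0) := by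
        have hc : ContinuousAt (fun r : ℝ => r ^ κ) 0 :=
          Real.continuousAt_rpow_const 0 κ (Or.inr hκ.le)
        have h2 : Tendsto (fun t₂ : ℝ => -t₂) (𝓝 (0:ℝ)) (𝓝 0) := by
          simpa using (continuous_neg.tendsto (0:ℝ))
        have h3 := hc.tendsto.comp h2
        simpa [Function.comp_def, Real.zero_rpow hκ.ne'] using h3
      have h4 : Tendsto (fun t₂ : ℝ => M * ((-t₁) ^ (-κ) * (-t₂) ^ κ)) (𝓝 (0:ℝ))
          (𝓝 (M * ((-t₁) ^ (-κ) * 0))) :=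
        (h1.const_mul _).const_mul _
      rw [mul_zero, mul_zero] at h4
      exact tendsto_nhdsWithin_of_tendsto_nhds h4
    refine ge_of_tendsto hg ?_
    filter_upwards [Ioo_mem_nhdsLT ht₁0] with t₂ ht₂
    have h := hbound t₂ ht₂
    have ht₂0 : 0 ≤ -t₂ := by linarith [ht₂.2]
    have ht₁0' : 0 ≤ -t₁ := by linarith
    rwa [Real.div_rpow ht₁0' ht₂0, Real.rpow_neg ht₂0, div_inv_eq_mul] at h
  have hae : (fun y => |K' t₁ y - K t₁ y|) =ᵐ[volume] 0 :=
    (integral_eq_zero_iff_of_nonneg (fun y => abs_nonneg _) hint).1 hzero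
  have hcont : Continuous fun y => K' t₁ y - K t₁ y :=
    (hA'.contDiff_slice ht₁).continuous.sub (hA.contDiff_slice ht₁).continuous
  have heq : (fun y => K' t₁ y - K t₁ y) = fun _ => (0:ℝ) := by
    refine (Continuous.ae_eq_iff_eq volume hcont continuous_const).1 ?_
    filter_upwards [hae] with y hy
    simpa [abs_eq_zero] using hy
  have hx := congrFun heq x
  simpa [sub_eq_zero] using hx

/-- **Every witness yields a canonical witness, unsteady at every slice; hence the six reduction
stubs and the terminal Liouville stub exclude witnesses** (the logic of the line, kernel-checked). -/
theorem noWitness_of (h1 : KernelCentring) (h2 : WitnessRegularity) (h3 : KernelMerging)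
    (h4 : KernelCovariance) (h5 : KernelSlaving) (h6 : NoSteadySlice) (h7 : NoCanonicalWitness) :
    ¬ ∃ (ν C Λ₀ : ℝ) (v : ℝ → E3 → E3) (q : ℝ → E3 → ℝ) (K : ℝ → E3 → ℝ),
      IsWitness ν C Λ₀ v q K := by
  rintro ⟨ν, C, Λ₀, v₀, q₀, K₀, hW₀⟩
  -- 1. centre the witness by its own kernel mean
  obtain ⟨B, q, hB, hW, hcen⟩ := h1 ν C Λ₀ v₀ q₀ K₀ hW₀
  set v : ℝ → E3 → E3 := fun t x => v₀ t (x + B t) - deriv B t with hv_def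
  set K : ℝ → E3 → ℝ := fun t x => K₀ t (x + B t) with hK_def
  obtain ⟨hν, hNS, hTI, hKc, hComp, hF⟩ := hW
  -- 2. scale-invariant bounds and differentiability of the adapted enstrophy
  obtain ⟨⟨C', hC'0, hb⟩, hd⟩ := h2 ν (2 * C) Λ₀ v q K ⟨hν, hNS, hTI, hKc, hComp, hF⟩ hcen
  -- the Type-I constant is nonnegative (the bound holds at `(t,x) = (−1,0)`)
  have hC : 0 ≤ 2 * C := by
    have h := hTI (-1) (by norm_num) 0
    rw [neg_neg, Real.sqrt_one, div_one] at h
    exact (norm_nonneg _).trans h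
  -- 3. pinning: Λ₀ = 2 and flat rescaled enstrophy A (−t)^{−2}, A = H(−1) > 0
  obtain ⟨hΛ, hflat⟩ := flat_of_bounds hF hd hKc hb
  have hApos : 0 < ∫ x, ‖curl (v (-1)) x‖ ^ 2 * K (-1) x := (hF _ _ rfl rfl).1 (-1) (by norm_num)
  -- vorticity on every slice (input of the steady-slice exclusion)
  have hcurl : ∀ t ∈ Iio (0:ℝ), ∃ x, curl (v t) x ≠ 0 := exists_curl_ne_zero_of_flat hApos hflat
  -- 4. the kernel is canonical (unique), by merging
  have hdrift : IsTypeIDriftPast (2 * C) v := ⟨hNS.smooth_velocity, hNS.divFree, hTI⟩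
  have huniq : IsUniqueKernel ν v K := isUniqueKernel_of_merging h3 hν hC hdrift hKc hComp
  -- 5. symmetry inheritance
  have hcov : IsSymmetryCovariant v K := h4 ν v K hν hKc hComp huniq
  -- 6. slaving
  obtain ⟨c₁, c₂, C₁, C₂, hc₁, hc₂, hC₁, hC₂, hcw⟩ := hComp
  obtain ⟨κ, M, hκ, hM, hsl⟩ := h5 ν (2 * C) C' c₁ c₂ C₁ C₂ hν hC hC'0 hc₁ hc₂ hC₁ hC₂
  have hslaved : IsSlaved κ M v K := hsl v K hdrift hb hKc hcw
  -- 7. the canonical witness; 8. dichotomy: a steady slice is excluded by `NoSteadySlice`,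
  -- an everywhere-unsteady canonical witness by the terminal Liouville stub
  have hcan : IsCanonicalWitness ν (2 * C) C' _ v q K :=
    { nu_pos := hν
      A_pos := hApos
      ns := hNS
      typeI := hTI
      kernel := hKc
      comparable := ⟨c₁, c₂, C₁, C₂, hc₁, hc₂, hC₁, hC₂, hcw⟩
      centred := hcen
      bounds := hb
      flat := hflat
      unique := huniq
      covariant := hcov
      slaved := ⟨κ, M, hκ, hM, hslaved⟩ }
  by_cases hun : ∀ s : ℝ, ∃ y, deriv (fun s' => lerayOrbit v s' y) s ≠ 0
  · exact h7 ⟨ν, 2 * C, C', _, v, q, K, hcan, hun⟩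
  · push Not at hun
    obtain ⟨s, hs⟩ := hun
    exact h6 ν (2 * C) v q hν hNS hTI hcurl s hs

/-- **`FrequencyRigidity` from the seven stubs** — the kernel-checked composition of the line:
its type is literally `stub₁-statement → … → stub₇-statement → AdaptedFrequency.FrequencyRigidity`
(hypotheses keyed by the registered stub names `Registered.stub_X`; no `sorry` in its closure). -/
theorem FrequencyRigidity_of (h1 : Registered.stub_kernelCentring)
    (h2 : Registered.stub_witnessRegularity) (h3 : Registered.stub_kernelMerging)
    (h4 : Registered.stub_kernelCovariance) (h5 : Registered.stub_kernelSlaving)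
    (h6 : Registered.stub_noSteadySlice) (h7 : Registered.stub_noCanonicalWitness) :
    Summit.NavierStokesRegularity.NavierStokesRegularity.Theses.AdaptedFrequency.FrequencyRigidity :=
  frequencyRigidity_iff.2 (noWitness_of h1 h2 h3 h4 h5 h6 h7)

/-- Wiring check: the registered stubs feed `FrequencyRigidity_of` exactly as stated (this
declaration inherits the stubs' `sorry`s through them; `FrequencyRigidity_of` itself is closed). -/
theorem frequencyRigidity_of_stubs : FrequencyRigidity' :=
  FrequencyRigidity_of stub_kernelCentring stub_witnessRegularity stub_kernelMerging
    stub_kernelCovariance stub_kernelSlaving stub_noSteadySlice stub_noCanonicalWitness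

/-! ## Anchors (PROVED): the vocabulary against the free case and the LANDED negative witnesses

Free case `v ≡ 0` (Disproof (A)'s witness minus positivity): the backward heat kernel at `(0,0)`
satisfies the kernel clauses, is comparable (`Negative.comparable_backwardHeatKernel`), CENTRED,
STEADY in similarity variables (`simKernel Γ = γ_ν`) and slaved with both sides `0`; only `0 < A`
fails there. Rigid rotation (B)/(B′) is not a Type-I drift on the past. The self-similar swirl (C)
is a Type-I drift with the heat kernel as adapted comparable kernel, centred, flat with `A > 0`, a
STEADY similarity profile, steady kernel and trivial slaving — it inhabits every drift-side clause
of the canonical class and has a steady slice: `stub_noSteadySlice` (momentum ⇒ Tsai) is where it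
dies. -/

/-- The backward heat kernel at `(0,0)` satisfies the five kernel clauses for the zero drift. -/
theorem kernelClauses_zero_backwardHeatKernel {ν : ℝ} (hν : 0 < ν) :
    KernelClauses ν 0 (backwardHeatKernel ν 0 (0 : E3)) :=
  isAdaptedBackwardKernel_iff.1 (isAdaptedBackwardKernel_backwardHeatKernel hν 0 0)

/-- In similarity variables the backward heat kernel is the STEADY Gaussian `γ_ν = G_ν`. -/
theorem simKernel_backwardHeatKernel {ν : ℝ} (hν : 0 < ν) (s : ℝ) (y : E3) :
    simKernel (backwardHeatKernel ν 0 (0:E3)) s y = Literature.Analysis.UnboundedOperators.heatKernel ν y := by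
  have ht : -Real.exp (-s) < 0 := neg_lt_zero.2 (Real.exp_pos _)
  have hE : Real.exp (-s) ≠ 0 := (Real.exp_pos _).ne'
  rw [simKernel, backwardHeatKernel_eq hν.le (0:E3) ht]
  simp only [finrank_euclideanSpace_fin, Nat.cast_ofNat, sub_zero, sub_neg_eq_add, zero_add,
    Literature.Analysis.UnboundedOperators.heatKernel]
  have h1 : (Real.exp (-s)) ^ (-(3:ℝ) / 2) = Real.exp ((3:ℝ) / 2 * s) := by
    rw [← Real.exp_mul]; congr 1; ring
  have h2 : ‖Real.exp (-s / 2) • y‖ ^ 2 = Real.exp (-s) * ‖y‖ ^ 2 := by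
    rw [norm_smul, Real.norm_of_nonneg (Real.exp_pos _).le, mul_pow, sq (Real.exp (-s / 2)),
      ← Real.exp_add]
    congr 2; ring
  have h3 : -(Real.exp (-s) * ‖y‖ ^ 2) / (4 * ν * Real.exp (-s)) = -‖y‖ ^ 2 / (4 * ν) := by
    field_simp
  have h4 : Real.exp (-(3:ℝ) / 2 * s) * Real.exp ((3:ℝ) / 2 * s) = 1 := by
    rw [← Real.exp_add]; convert Real.exp_zero using 2; ring
  rw [h1, h2, h3]
  calc Real.exp (-(3:ℝ) / 2 * s) *
        ((4 * Real.pi * ν) ^ (-(3:ℝ) / 2) * Real.exp ((3:ℝ) / 2 * s) * Real.exp (-‖y‖ ^ 2 / (4 * ν)))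
      = (Real.exp (-(3:ℝ) / 2 * s) * Real.exp ((3:ℝ) / 2 * s)) *
          ((4 * Real.pi * ν) ^ (-(3:ℝ) / 2) * Real.exp (-‖y‖ ^ 2 / (4 * ν))) := by ring
    _ = (4 * Real.pi * ν) ^ (-(3:ℝ) / 2) * Real.exp (-‖y‖ ^ 2 / (4 * ν)) := by rw [h4, one_mul]

/-- Free case of slaving: zero drift, steady kernel — both sides vanish. -/
theorem isSlaved_zero_backwardHeatKernel {ν : ℝ} (hν : 0 < ν) (κ M : ℝ) :
    IsSlaved κ M 0 (backwardHeatKernel ν 0 (0:E3)) := by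
  intro s
  simp only [simKernel_backwardHeatKernel hν, lerayOrbit_zero, Pi.zero_apply, deriv_const,
    abs_zero, norm_zero, zero_mul, integral_zero, mul_zero, le_refl]

/-- The backward heat kernel at `(0,0)` is CENTRED for every drift tangent to nothing in
particular: `∫ K x = 0` (odd integrand). -/
theorem integral_backwardHeatKernel_smul_self {ν : ℝ} (t : ℝ) :
    (∫ x, backwardHeatKernel ν 0 (0:E3) t x • x) = (0 : E3) := by
  have heven : ∀ x : E3, backwardHeatKernel ν 0 (0:E3) t (-x) = backwardHeatKernel ν 0 (0:E3) t x :=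
    fun x => by simp [backwardHeatKernel, Literature.Analysis.UnboundedOperators.heatKernel_neg]
  set I : E3 := ∫ x, backwardHeatKernel ν 0 (0:E3) t x • x with hI
  have hneg : I = -I := by
    calc I = ∫ x, backwardHeatKernel ν 0 (0:E3) t (-x) • (-x) := by
          rw [hI]; exact (integral_neg_eq_self (fun x => backwardHeatKernel ν 0 (0:E3) t x • x) volume).symm
      _ = ∫ x, -(backwardHeatKernel ν 0 (0:E3) t x • x) := by
          congr 1; funext x; rw [heven x, smul_neg]
      _ = -I := by rw [integral_neg]
  have h2 : (2:ℝ) • I = 0 := by rw [two_smul]; nth_rewrite 2 [hneg]; exact add_neg_cancel I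
  exact (smul_eq_zero.1 h2).resolve_left two_ne_zero

/-- More generally the heat kernel pairs to zero with every ODD vector field. -/
theorem integral_backwardHeatKernel_smul_odd {ν : ℝ} (t : ℝ) {w : E3 → E3}
    (hw : ∀ x, w (-x) = -w x) :
    (∫ x, backwardHeatKernel ν 0 (0:E3) t x • w x) = (0 : E3) := by
  have heven : ∀ x : E3, backwardHeatKernel ν 0 (0:E3) t (-x) = backwardHeatKernel ν 0 (0:E3) t x :=
    fun x => by simp [backwardHeatKernel, Literature.Analysis.UnboundedOperators.heatKernel_neg]
  set I : E3 := ∫ x, backwardHeatKernel ν 0 (0:E3) t x • w x with hI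
  have hneg : I = -I := by
    calc I = ∫ x, backwardHeatKernel ν 0 (0:E3) t (-x) • w (-x) := by
          rw [hI]; exact (integral_neg_eq_self (fun x => backwardHeatKernel ν 0 (0:E3) t x • w x) volume).symm
      _ = ∫ x, -(backwardHeatKernel ν 0 (0:E3) t x • w x) := by
          congr 1; funext x; rw [heven x, hw x, smul_neg]
      _ = -I := by rw [integral_neg]
  have h2 : (2:ℝ) • I = 0 := by rw [two_smul]; nth_rewrite 2 [hneg]; exact add_neg_cancel I
  exact (smul_eq_zero.1 h2).resolve_left two_ne_zero

/-- Free case of centring: the backward heat kernel is centred and sees no flow. -/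
theorem isCentred_zero_backwardHeatKernel {ν : ℝ} (hν : 0 < ν) :
    IsCentred 0 (backwardHeatKernel ν 0 (0:E3)) :=
  ⟨fun t _ => integral_backwardHeatKernel_smul_self t, fun t _ => by simp⟩

/-! ### (B), (B′): rigid rotation is not a Type-I drift on the past -/

/-- A STEADY field with a non-zero value violates the global Type-I bound for every constant `C`
(the bound forces decay `‖v(t,x)‖ → 0` as `t → −∞`). -/
theorem not_typeIBound_steady {C : ℝ} {w : E3 → E3} {x : E3} (hx : w x ≠ 0) :
    ¬ TypeIBound C (fun _ => w) := by
  intro h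
  have ha : 0 < ‖w x‖ := norm_pos_iff.2 hx
  have hT0 : 0 < (|C| + 1) / ‖w x‖ := div_pos (by positivity) ha
  have hpos : 0 < ((|C| + 1) / ‖w x‖) ^ 2 := pow_pos hT0 2
  have h1 : ‖w x‖ ≤ C / Real.sqrt (-(-(((|C| + 1) / ‖w x‖) ^ 2))) :=
    h _ (show -(((|C| + 1) / ‖w x‖) ^ 2) < 0 by linarith) x
  rw [neg_neg, Real.sqrt_sq hT0.le, div_div_eq_mul_div] at h1
  have h2 : C * ‖w x‖ / (|C| + 1) < ‖w x‖ := by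
    rw [div_lt_iff₀ (by positivity)]
    nlinarith [le_abs_self C, ha]
  linarith

/-- `e₃ × e₁ ≠ 0` (its second coordinate is `1`). -/
theorem rot_single_zero_ne_zero : Negative.rot (EuclideanSpace.single (0 : Fin 3) (1 : ℝ)) ≠ 0 := by
  intro h
  have h1 : Negative.rot (EuclideanSpace.single (0 : Fin 3) (1 : ℝ)) 1 =
      (EuclideanSpace.single (0 : Fin 3) (1 : ℝ)) 0 := Negative.rot_apply_one _
  rw [h] at h1
  simp at h1

/-- **(B)** Rigid rotation `e₃ × x` (Disproof (B)'s witness for the LOCAL-Type-I variant,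
`Negative.frequencyRigidity_false_with_local_typeI`) violates the GLOBAL Type-I bound for every
`C`: it is no `IsWitness` and no `IsTypeIDriftPast`. -/
theorem not_typeIBound_rot (C : ℝ) : ¬ TypeIBound C (fun _ x => Negative.rot x) :=
  not_typeIBound_steady (w := fun x => Negative.rot x) rot_single_zero_ne_zero

/-- **(B′)** Slow rigid rotation `Ω e₃ × x`, `Ω ≠ 0` (Disproof (B′)'s witnesses with arbitrarily
small LOCAL constant, `Negative.frequencyRigidity_false_with_local_typeI_small`), is not a Type-I
drift on the past for any `C`: the hypotheses of `stub_kernelMerging` / `stub_kernelSlaving`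
exclude it, consistently with the uniform Lyapunov constant needing `‖U‖ ≤ C` GLOBALLY. -/
theorem not_isTypeIDriftPast_smul_rot {Ω : ℝ} (hΩ : Ω ≠ 0) (C : ℝ) :
    ¬ IsTypeIDriftPast C (fun _ x => (Ω • Negative.rot) x) := fun h =>
  not_typeIBound_steady (w := fun x => (Ω • Negative.rot) x)
    (x := EuclideanSpace.single (0 : Fin 3) (1 : ℝ))
    (show Ω • Negative.rot _ ≠ 0 from smul_ne_zero hΩ rot_single_zero_ne_zero) h.2.2

/-! ### (C): the self-similar swirl inhabits every drift-side clause and HAS a steady slice -/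

/-- The swirl of Disproof (C) is a Type-I divergence-free smooth drift on the past (`C = 2`). -/
theorem isTypeIDriftPast_swirl : IsTypeIDriftPast 2 Negative.swirl :=
  ⟨Negative.isSmoothSpaceTimeOn_swirl, fun t _ => Negative.isDivFree_swirl t, Negative.typeIBound_swirl⟩

/-- The backward heat kernel satisfies the five kernel clauses for the swirl (tangential flow). -/
theorem kernelClauses_swirl {ν : ℝ} (hν : 0 < ν) :
    KernelClauses ν Negative.swirl (backwardHeatKernel ν 0 (0:E3)) :=
  Negative.kernelClauses_backwardHeatKernel hν _ (fun t _ x => Negative.inner_self_swirl t x)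

/-- The profile `V = χ · rot` of the swirl is odd. -/
theorem V_neg (y : E3) : Negative.V (-y) = -Negative.V y := by
  simp [Negative.V, Negative.χ, norm_neg, map_neg]

/-- The swirl is odd in space at every time. -/
theorem swirl_neg (t : ℝ) (x : E3) : Negative.swirl t (-x) = -Negative.swirl t x := by
  simp [Negative.swirl, smul_neg, V_neg]

/-- The swirl with the heat kernel is CENTRED. -/
theorem isCentred_swirl_backwardHeatKernel (ν : ℝ) :
    IsCentred Negative.swirl (backwardHeatKernel ν 0 (0:E3)) :=
  ⟨fun t _ => integral_backwardHeatKernel_smul_self t,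
    fun t _ => integral_backwardHeatKernel_smul_odd t (swirl_neg t)⟩

/-- The swirl with the heat kernel is FLAT with `A = ∫F > 0` (`Negative.integral_F_pos`): the
exact backward-self-similar enstrophy law `H(t) = A(−t)^{−2}`, `Λ ≡ 2`. -/
theorem flat_swirl {ν : ℝ} (hν : 0 < ν) :
    ∀ t ∈ Iio (0:ℝ), (∫ x, ‖curl (Negative.swirl t) x‖ ^ 2 * backwardHeatKernel ν 0 (0:E3) t x) =
      (∫ y, Negative.F ν y) * (-t) ^ (-(2:ℝ)) := by
  intro t ht
  have ht0 : t < 0 := ht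
  rw [Negative.adaptedEnstrophy_swirl hν ht0, Real.rpow_neg (by linarith), Real.rpow_two, neg_sq,
    div_eq_mul_inv]

/-- **The similarity profile of the swirl is STEADY**: `lerayOrbit swirl s = V` for every `s`. -/
theorem lerayOrbit_swirl (s : ℝ) (y : E3) : lerayOrbit Negative.swirl s y = Negative.V y := by
  have h1 : Negative.sc (-Real.exp (-s)) = Real.exp (s / 2) := by
    rw [Negative.sc, neg_neg, sqrt_exp_neg, ← Real.exp_neg]
    congr 1; ring
  have h2 : Real.exp (s / 2) * Real.exp (-s / 2) = 1 := by
    rw [← Real.exp_add]; convert Real.exp_zero using 2; ring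
  have h3 : Real.exp (-s / 2) * Real.exp (s / 2) = 1 := by rw [mul_comm]; exact h2
  rw [lerayOrbit_apply, Negative.swirl, h1, smul_smul, h3, one_smul, smul_smul, h2, one_smul]

/-- Hence the swirl HAS a steady slice (every slice): the hypothesis `stub_noSteadySlice` refutes
for Navier–Stokes flows holds for it at every `s`. -/
theorem deriv_lerayOrbit_swirl (s : ℝ) (y : E3) :
    deriv (fun s' => lerayOrbit Negative.swirl s' y) s = 0 := by
  simp only [lerayOrbit_swirl, deriv_const]

/-- The swirl with its steady Gaussian kernel is slaved with both sides `0` (steady profile,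
steady kernel). -/
theorem isSlaved_swirl_backwardHeatKernel {ν : ℝ} (hν : 0 < ν) (κ M : ℝ) :
    IsSlaved κ M Negative.swirl (backwardHeatKernel ν 0 (0:E3)) := by
  intro s
  simp only [simKernel_backwardHeatKernel hν, lerayOrbit_swirl, deriv_const, abs_zero, norm_zero,
    zero_mul, integral_zero, mul_zero, le_refl]

end Summit.NavierStokesRegularity.NavierStokesRegularity.Cruxes.FrequencyRigidity.KernelFadingMemory
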